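import Summits.QuantumFields.BalabanUV.Beta.GAN24.WSlotSourceZeroMode

/-!
# `BalabanUV.Beta.GAN24.WSlotSourceZeroModeStep` — binder row G-an2-4 ∕ (CONV-C), W-slot road «W3» (gan24-p1 `SKELETON-W3.md` v1.0.2 §8.3),
# ROW W3-F2a `hZ : ∀ m, Zfree (b m)` (typer `GAN24/Formal/LEAVES.md` v3.11 § IV-C; journal INTENT «W3-ZS*» l.9181), Part B of the assembly:
# THE STEP KERNEL `K♮_j = unitK s_f s_m (KInvStep Lc j)` AND leaf-04's LITERAL BRACKET — the transversal ff zero mode of the source `b_j` and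
# its cell form `zmode`, FROM the four (S3c)-channel ff double-leg bond sums (two exchange trees, two second-response halves)

NOT IN PRINT; OUR BOOKKEEPING (G-an2-4 formalisation swarm, leaf prover `b2b-balaban-gan24-formalise-leaf-20`, gen 18; name PROVISIONAL).
HONEST FRAMING (cell contract, verbatim): «discharging `BetaPertH` makes Bałaban's UV stability UNCONDITIONAL — a real constructive-QFT result;
it is NOT the continuum limit and NOT the Clay problem.»  HONEST DEPENDENCY (verbatim): «continuum YM on T⁴ ⇐ BetaPertH ∧ nine spine estimates
(0/9 proved); BetaPertH ⇐ (D1) ∧ (D4) ∧ CAP+tail; G-an2-4 gates asym, D1 and NE2/3/4.»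

WHAT ([folklore] bookkeeping over TREE objects BY NAME; generic `d`, every `Lc ≥ 1`, every `j`, all units; 0 def, 0 cite, 0 `def … : Prop`, 0 sorry):
* §6 **`inner_value_unitKStep_eq_zero`** — for `K♮_j`, first tables `S` (`LocStencil`), `M` (`VertexFamily`), a jointly block-covariant
  `LocStencilFM` mixed table `M₂`: IF the ff double-leg sums of the two exchange-tree middles `(dM_b ∘ K♮_j) ∘ dM_{b′}`, `(dM_{b′} ∘ K♮_j) ∘ dM_b`
  and of the two second-response halves `dM (K2OfK … b′) … b`, `dM (K2OfK … b) … b′` have bond series (over `b′ = (κ′, u′)`, fixed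
  `b = (κ, u)`) with `HasSum` zero, THEN the value part `mmRead Lc (K3OfK K♮_j Lc S M (W2SymOfK K♮_j Lc S M 0 M₂) b b′)` has transversal inner
  sum zero on every ff slot.  Ingredients BY NAME: leaf-06's `ExchangeReadout.K3OfK_apply_eq` ∕ `exchange_eq_sandwich` ∕ `loc_dM` and the
  site-free charges `StepResolventLegCharges.hasSum_KInvStep_row/col` ∕ `hasSum_unitK_row/col`; leaf-14's `W`-term reduction
  `MixedChannelBondSums.hasSum_tsum_prod_W2SymOfK_sub_resp_unitKStep` (the mixed channel dies on (S2c)); an2's shape bricks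
  `vertexFamily₂_mixOfK` ∕ `vertexFamily_K2OfK` ∕ `vertexFamily₂_resp`; an5's `Tame`∕`Loc` calculus; Part A's `sandwich_transfer`.
* §7 **`inner_bracket_eq_zero`**, **`zmode_bracket_eq_zero`** — leaf-04's LITERAL bracket of `T2RecursionAffine.unitS₂_T2Of_succ_affine`
  (`K♮_j`, `S♮_j = unitS … (Spure … j)`, `M♮_j = unitM … (M1 … j)`, `M₂♮_j = unitM₂ … (M2Of mixFF j)`, scalar `cE₂·Lc^{2(d+1)}`, border
  `cB • mfNeg ∘ vh₂S` with NO ff entries — the `hBff` hypothesis of that theorem, `StepJetData.mfNeg_inl_inl`): ROW W3-F2a's `hZ` at member `j` in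
  BOTH currencies (pointwise transversal form of record per ref2 R51-2∕(w2); cell form by leaf-16's `zmode_eq_zero_of_inner_eq_zero`), GIVEN the
  level-`j` shape data of `S♮_j`, `M♮_j`, `M₂♮_j` and the four channel bond sums of §6 at that data — leaf-06-g9's announced «W3-S3C*» PART 6.
HONEST: END-as-function for ROW W3-F2a; the row closes only when the four channel bond sums land (leaf-06-g9 (B)(C), journal l.9159) and the
shape data are supplied (the wall's ∕ «E3Shape»'s level-`j` rows); NOT «T2Shape», NOT (hW, hWall), 0∕2 wall binders; NOT «W-slot closed» (nor
under an undischarged pin), NEVER «G-an2-4 closed»; NOT BetaPertH, NOT continuum, NOT Clay.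
-/

noncomputable section

open Finset
open scoped BigOperators
open Literature.MathematicalPhysics.QuantumFieldTheory
open Literature.MathematicalPhysics.QuantumFieldTheory.Balaban1983to89
open Literature.MathematicalPhysics.QuantumFieldTheory.Balaban1983to89.Beta
open AffineAveraging (Site)
open B12Sec2to5 (l1)
open ExpKernelCalculus (MKer Decays BiLoc VertexFamily comp shiftK)
open OneStepResolventKernel (Fib LocStencil)
open OneStepKernelFamily (KInvStep decays_KInvStep)
open StepJetData (mfNeg mfNeg_inl_inl)
open SecondOrderResponse (dM K2OfK vertex2OfK mixOfK W2OfK W2SymOfK LocStencilFM)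
open BalabanStepW2 (K3OfK Spure M1 M2Of)
open BalabanStepJetsSucc (mmRead mmRead_inl_inl)
open Summit.QuantumFields.BalabanUV.Beta.HessKerDressedUnits (unitK unitS decays_unitK)
open Summit.QuantumFields.BalabanUV.Beta.SecondOrderUnits (unitM unitM₂)
open Summit.QuantumFields.BalabanUV.Beta.GAN24.CombesThomas (sfStep smStep)
open Summit.QuantumFields.BalabanUV.Beta.TameKernelCalculus (Spr Loc Tame)
open Summit.QuantumFields.BalabanUV.Beta.GAN24.BiStencilZeroMode (zmode)
open Summit.QuantumFields.BalabanUV.Beta.GAN24.TransversalZeroMode (zmode_eq_zero_of_inner_eq_zero)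
open Summit.QuantumFields.BalabanUV.Beta.GAN24.ExchangeReadout (K3OfK_apply_eq)
open Summit.QuantumFields.BalabanUV.Beta.GAN24.WSlotSourceZeroMode (W2SymOfK_zero_eq sandwich_transfer inner_eq_zero_of_hasSum_pair)

namespace Summit.QuantumFields.BalabanUV.Beta.GAN24.WSlotSourceZeroModeStep

variable {d : ℕ}

/-! ## §6 ROW W3-F2a through the step kernel `K♮_j = unitK s_f s_m (KInvStep Lc j)`: the bracket's zero mode from four ff double-leg
bond sums (the two exchange trees and the two second-response halves) — the mixed channel and the `W`-term reduction are leaf-14's tree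
theorems, the border has no ff entries -/

section Step

variable {Lc : ℕ} [NeZero Lc] (sf sm : ℝ) (j : ℕ)
  {S M : Fin (d + 1) → Site (d + 1) → MKer (d + 1) (Fib d)} {Cs δs CM δM : ℝ}
  {M₂ : Fin (d + 1) → Site (d + 1) → Fin (d + 1) → Site (d + 1) → MKer (d + 1) (Fib d)} {C₂ δ₂ : ℝ}

/-- NOT IN PRINT; OUR BOOKKEEPING.  **THE VALUE PART OF THE SOURCE HAS ZERO TRANSVERSAL ff ZERO MODE, GIVEN THE FOUR (S3c)-CHANNEL BOND
SUMS.**  For the step kernel `K♮_j = unitK s_f s_m (KInvStep Lc j)` (all units, every `j`), first tables `S` (`LocStencil`, rate `δs > 0`) and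
`M` (`VertexFamily` at blocking `Lc`, rate `δM > 0`), a jointly block-covariant `LocStencilFM` mixed table `M₂` (rate `δ₂ > 0`), every first bond
`(κ, u)`, second direction `κ′` and field pair `(α, β)`: IF the ff double-leg sums of the two exchange-tree middles
`(dM_{(κ,u)} ∘ K♮_j) ∘ dM_{(κ′,u′)}`, `(dM_{(κ′,u′)} ∘ K♮_j) ∘ dM_{(κ,u)}` and of the two second-response halves `dM (K2OfK … (κ′,u′)) … (κ,u)`,
`dM (K2OfK … (κ,u)) … (κ′,u′)` have bond series (over `u′`) with `HasSum` zero — leaf-06's announced «W3-S3C*» PART 6 in the double-leg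
currency — THEN `Σ'_{u′} Σ'_x Σ'_z mmRead Lc (K3OfK K♮_j Lc S M (W2SymOfK K♮_j Lc S M 0 M₂) κ u κ′ u′) x z (inl α) (inl β) = 0`.
Route: `K3OfK_apply_eq` + `exchange_eq_sandwich` (the two trees are sandwiches of localised middles), the `W`-term's bond sum is its
second-response part (leaf-14's `MixedChannelBondSums.hasSum_tsum_prod_W2SymOfK_sub_resp_unitKStep`, (S2c)), §5 for the three sandwiches. -/
theorem inner_value_unitKStep_eq_zero (hS : LocStencil S Cs δs) (hδs : 0 < δs) (hM : VertexFamily M Lc CM δM) (hδM : 0 < δM)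
    (hM₂ : LocStencilFM Lc M₂ C₂ δ₂) (hδ₂ : 0 < δ₂)
    (hM₂t : ∀ (κ : Fin (d + 1)) (u : Site (d + 1)) (ρ : Fin (d + 1)) (w t : Site (d + 1)),
      M₂ κ (u + (Lc : ℤ) • t) ρ (w + t) = shiftK (-((Lc : ℤ) • t)) (M₂ κ u ρ w))
    (κ : Fin (d + 1)) (u : Site (d + 1)) (κ' α β : Fin (d + 1))
    (hE₁ : HasSum (fun u' : Site (d + 1) => ∑' yw : Site (d + 1) × Site (d + 1),
      comp (comp (dM (unitK sf sm (KInvStep (d := d) Lc j)) Lc S M κ u) (unitK sf sm (KInvStep (d := d) Lc j)))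
        (dM (unitK sf sm (KInvStep (d := d) Lc j)) Lc S M κ' u') yw.1 yw.2 (Sum.inl α) (Sum.inl β)) 0)
    (hE₂ : HasSum (fun u' : Site (d + 1) => ∑' yw : Site (d + 1) × Site (d + 1),
      comp (comp (dM (unitK sf sm (KInvStep (d := d) Lc j)) Lc S M κ' u') (unitK sf sm (KInvStep (d := d) Lc j)))
        (dM (unitK sf sm (KInvStep (d := d) Lc j)) Lc S M κ u) yw.1 yw.2 (Sum.inl α) (Sum.inl β)) 0)
    (hR₁ : HasSum (fun u' : Site (d + 1) => ∑' yw : Site (d + 1) × Site (d + 1),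
      dM (K2OfK (unitK sf sm (KInvStep (d := d) Lc j)) Lc S M κ' u') Lc S M κ u yw.1 yw.2 (Sum.inl α) (Sum.inl β)) 0)
    (hR₂ : HasSum (fun u' : Site (d + 1) => ∑' yw : Site (d + 1) × Site (d + 1),
      dM (K2OfK (unitK sf sm (KInvStep (d := d) Lc j)) Lc S M κ u) Lc S M κ' u' yw.1 yw.2 (Sum.inl α) (Sum.inl β)) 0) :
    (∑' u', ∑' x, ∑' z, mmRead Lc (K3OfK (unitK sf sm (KInvStep (d := d) Lc j)) Lc S M
      (W2SymOfK (unitK sf sm (KInvStep (d := d) Lc j)) Lc S M 0 M₂) κ u κ' u') x z (Sum.inl α) (Sum.inl β)) = 0 := by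
  -- the step kernel: decay, spread, site-free charges
  obtain ⟨δ, C, hδ, hC, hK⟩ := decays_KInvStep (d := d) (Lc := Lc) j
  have hKu : Decays (unitK sf sm (KInvStep (d := d) Lc j)) (max |sf| |sm| * C * max |sf| |sm|) δ := decays_unitK hK
  have hCu : 0 ≤ max |sf| |sm| * C * max |sf| |sm| := hKu.nonneg (Sum.inl 0)
  have hSpr : Spr (unitK sf sm (KInvStep (d := d) Lc j)) := ⟨_, _, hδ, hKu⟩
  set σ : ℝ := ((((Lc ^ (j + 1) : ℕ) : ℝ)) ^ (d + 1 + 1))⁻¹ with hσ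
  have hrow : ∀ (f : Fib d) (w : Site (d + 1)), HasSum (fun x' : Site (d + 1) =>
      unitK sf sm (KInvStep (d := d) Lc j) (((Lc : ℕ) : ℤ) • x') w (Sum.inr α) f)
      (Sum.elim (fun a => -(if a = α then sm * σ * sf else 0)) (fun _ => (0 : ℝ)) f) := by
    intro f w
    have h := StepResolventLegCharges.hasSum_unitK_row sf sm (StepResolventLegCharges.hasSum_KInvStep_row (d := d) (Lc := Lc) j α f w)
    rcases f with a | m
    · simp only [Sum.elim_inl, HessKerDressedUnits.legScale_inl] at h ⊢
      convert h using 1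
      split_ifs <;> ring
    · simp only [Sum.elim_inr, HessKerDressedUnits.legScale_inr, mul_zero, zero_mul] at h ⊢
      exact h
  have hcol : ∀ (g : Fib d) (w : Site (d + 1)), HasSum (fun z' : Site (d + 1) =>
      unitK sf sm (KInvStep (d := d) Lc j) w (((Lc : ℕ) : ℤ) • z') g (Sum.inr β))
      (Sum.elim (fun b => if b = β then sf * σ * sm else 0) (fun _ => (0 : ℝ)) g) := by
    intro g w
    have h := StepResolventLegCharges.hasSum_unitK_col sf sm (StepResolventLegCharges.hasSum_KInvStep_col (d := d) (Lc := Lc) j β g w)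
    rcases g with b | m
    · simp only [Sum.elim_inl, HessKerDressedUnits.legScale_inl] at h ⊢
      convert h using 1
      split_ifs <;> ring
    · simp only [Sum.elim_inr, HessKerDressedUnits.legScale_inr, mul_zero, zero_mul] at h ⊢
      exact h
  -- localisation of the pieces (an5's existential currency)
  have lb : ∀ (μ : Fin (d + 1)) (y : Site (d + 1)), Loc (dM (unitK sf sm (KInvStep (d := d) Lc j)) Lc S M μ y) :=
    fun μ y => ExchangeReadout.loc_dM (N := Lc) hKu hδ hS hδs hM hδM μ y
  -- common rate for the second-order bricks
  set m : ℝ := min (min (min δ δs) δM) δ₂ with hm_def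
  have hm : 0 < m := lt_min (lt_min (lt_min hδ hδs) hδM) hδ₂
  have hm2 : m ≤ δ₂ := min_le_right _ _
  have hmM : m ≤ δM := (min_le_left _ _).trans (min_le_right _ _)
  have hms : m ≤ δs := (min_le_left _ _).trans ((min_le_left _ _).trans (min_le_right _ _))
  have hmK : m ≤ δ := (min_le_left _ _).trans ((min_le_left _ _).trans (min_le_left _ _))
  have hCs : 0 ≤ Cs := (hS 0 0).nonneg (Sum.inl 0)
  have hCM : 0 ≤ CM := (hM 0 0).nonneg (Sum.inl 0)
  have hKm : Decays (unitK sf sm (KInvStep (d := d) Lc j)) (max |sf| |sm| * C * max |sf| |sm|) m :=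
    OneStepResolventKernel.decays_mono hKu hCu le_rfl hmK
  have hSm : LocStencil S Cs m := BalabanStepJets.locStencil_mono hS hCs hms
  have hMm : VertexFamily M Lc CM m := fun μ y => OneStepResolventKernel.biLoc_mono (hM μ y) hCM hmM
  have hM₂m : LocStencilFM Lc M₂ C₂ m := hM₂.mono hm2
  have hmixF := SecondOrderResponse.vertexFamily₂_mixOfK (N := Lc) hKm hCu hM₂m hm
  have hm8 : 0 < m / 8 := by positivity
  have lmix : ∀ (μ : Fin (d + 1)) (y : Site (d + 1)) (ν : Fin (d + 1)) (y' : Site (d + 1)),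
      Loc (mixOfK (unitK sf sm (KInvStep (d := d) Lc j)) Lc M₂ μ y ν y') :=
    fun μ y ν y' => ⟨_, _, _, _, hm8, hmixF μ y ν y'⟩
  have hK2 := SecondOrderResponse.vertexFamily_K2OfK (N := Lc) hKm hCu hm hSm hMm
  have hS8 : LocStencil S Cs (m / 8) := BalabanStepJets.locStencil_mono hS hCs (by linarith)
  have hM8 : VertexFamily M Lc CM (m / 8) := fun μ y => OneStepResolventKernel.biLoc_mono (hM μ y) hCM (by linarith)
  have hrespF := SecondOrderResponse.vertexFamily₂_resp hK2 hS8 hM8 hm8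
  have hm82 : 0 < m / 8 / 2 := by positivity
  have lresp : ∀ (μ : Fin (d + 1)) (y : Site (d + 1)) (ν : Fin (d + 1)) (y' : Site (d + 1)),
      Loc (dM (K2OfK (unitK sf sm (KInvStep (d := d) Lc j)) Lc S M ν y') Lc S M μ y) :=
    fun μ y ν y' => ⟨_, _, _, _, hm82, hrespF μ y ν y'⟩
  have lW : ∀ (μ : Fin (d + 1)) (y : Site (d + 1)) (ν : Fin (d + 1)) (y' : Site (d + 1)),
      Loc (W2SymOfK (unitK sf sm (KInvStep (d := d) Lc j)) Lc S M 0 M₂ μ y ν y') := by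
    intro μ y ν y'
    rw [W2SymOfK_zero_eq]
    exact (((lmix μ y ν y').add (lmix ν y' μ y)).add ((lresp μ y ν y').smul _)).add ((lresp ν y' μ y).smul _)
  -- the three sandwiched channels in the pair currency (§5)
  obtain ⟨pE₁, zE₁⟩ := sandwich_transfer (N := Lc) hKu hδ α β hrow hcol
    (V := fun u' => comp (comp (dM (unitK sf sm (KInvStep (d := d) Lc j)) Lc S M κ u) (unitK sf sm (KInvStep (d := d) Lc j)))
      (dM (unitK sf sm (KInvStep (d := d) Lc j)) Lc S M κ' u'))
    (fun u' => ((lb κ u).comp_spr hSpr).comp (lb κ' u')) hE₁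
  obtain ⟨pE₂, zE₂⟩ := sandwich_transfer (N := Lc) hKu hδ α β hrow hcol
    (V := fun u' => comp (comp (dM (unitK sf sm (KInvStep (d := d) Lc j)) Lc S M κ' u') (unitK sf sm (KInvStep (d := d) Lc j)))
      (dM (unitK sf sm (KInvStep (d := d) Lc j)) Lc S M κ u))
    (fun u' => ((lb κ' u').comp_spr hSpr).comp (lb κ u)) hE₂
  -- the `W`-term: its ff double-leg bond sum is its second-response part's (leaf-14), which vanishes by hypothesis
  have hW0 : HasSum (fun u' : Site (d + 1) => ∑' yw : Site (d + 1) × Site (d + 1),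
      W2SymOfK (unitK sf sm (KInvStep (d := d) Lc j)) Lc S M 0 M₂ κ u κ' u' yw.1 yw.2 (Sum.inl α) (Sum.inl β)) 0 := by
    have h := MixedChannelBondSums.hasSum_tsum_prod_W2SymOfK_sub_resp_unitKStep sf sm j hS hδs hM hδM hM₂ hδ₂ hM₂t κ u κ'
      (Sum.inl α) (Sum.inl β)
    have h2 := h.add ((hR₁.add hR₂).mul_left (1 / 2 : ℝ))
    rw [show (0 : ℝ) + 1 / 2 * (0 + 0) = 0 by norm_num] at h2
    exact h2.congr_fun fun u' => by ring
  obtain ⟨pW, zW⟩ := sandwich_transfer (N := Lc) hKu hδ α β hrow hcol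
    (V := fun u' => W2SymOfK (unitK sf sm (KInvStep (d := d) Lc j)) Lc S M 0 M₂ κ u κ' u') (fun u' => lW κ u κ' u') hW0
  -- the entry formula: two exchange sandwiches minus the `W` sandwich
  have hv : ∀ u' x z, mmRead Lc (K3OfK (unitK sf sm (KInvStep (d := d) Lc j)) Lc S M
        (W2SymOfK (unitK sf sm (KInvStep (d := d) Lc j)) Lc S M 0 M₂) κ u κ' u') x z (Sum.inl α) (Sum.inl β) =
      mmRead Lc (comp (comp (unitK sf sm (KInvStep (d := d) Lc j))
          (comp (comp (dM (unitK sf sm (KInvStep (d := d) Lc j)) Lc S M κ u) (unitK sf sm (KInvStep (d := d) Lc j)))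
            (dM (unitK sf sm (KInvStep (d := d) Lc j)) Lc S M κ' u'))) (unitK sf sm (KInvStep (d := d) Lc j))) x z (Sum.inl α) (Sum.inl β)
      + mmRead Lc (comp (comp (unitK sf sm (KInvStep (d := d) Lc j))
          (comp (comp (dM (unitK sf sm (KInvStep (d := d) Lc j)) Lc S M κ' u') (unitK sf sm (KInvStep (d := d) Lc j)))
            (dM (unitK sf sm (KInvStep (d := d) Lc j)) Lc S M κ u))) (unitK sf sm (KInvStep (d := d) Lc j))) x z (Sum.inl α) (Sum.inl β)
      - mmRead Lc (comp (comp (unitK sf sm (KInvStep (d := d) Lc j))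
          (W2SymOfK (unitK sf sm (KInvStep (d := d) Lc j)) Lc S M 0 M₂ κ u κ' u')) (unitK sf sm (KInvStep (d := d) Lc j)))
            x z (Sum.inl α) (Sum.inl β) := by
    intro u' x z
    simp only [mmRead_inl_inl]
    rw [K3OfK_apply_eq, ExchangeReadout.exchange_eq_sandwich hSpr (lb κ u) (lb κ' u'),
      ExchangeReadout.exchange_eq_sandwich hSpr (lb κ' u') (lb κ u)]
  -- assemble in the pair currency
  have hpV : ∀ u', Summable fun xz : Site (d + 1) × Site (d + 1) =>
      mmRead Lc (K3OfK (unitK sf sm (KInvStep (d := d) Lc j)) Lc S M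
        (W2SymOfK (unitK sf sm (KInvStep (d := d) Lc j)) Lc S M 0 M₂) κ u κ' u') xz.1 xz.2 (Sum.inl α) (Sum.inl β) := by
    intro u'
    refine (((pE₁ u').add (pE₂ u')).sub (pW u')).congr fun xz => ?_
    rw [hv u' xz.1 xz.2]
  have hzV : HasSum (fun u' => ∑' xz : Site (d + 1) × Site (d + 1),
      mmRead Lc (K3OfK (unitK sf sm (KInvStep (d := d) Lc j)) Lc S M
        (W2SymOfK (unitK sf sm (KInvStep (d := d) Lc j)) Lc S M 0 M₂) κ u κ' u') xz.1 xz.2 (Sum.inl α) (Sum.inl β)) 0 := by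
    have h := (zE₁.add zE₂).sub zW
    simp only [add_zero, sub_zero] at h
    refine h.congr_fun fun u' => ?_
    rw [← (pE₁ u').tsum_add (pE₂ u'), ← ((pE₁ u').add (pE₂ u')).tsum_sub (pW u')]
    exact tsum_congr fun xz => hv u' xz.1 xz.2
  exact inner_eq_zero_of_hasSum_pair hpV hzV

end Step

/-! ## §7 ROW W3-F2a at leaf-04's LITERAL bracket: both `Zfree` currencies -/

section Literal

variable {Lc : ℕ} [NeZero Lc] (cE cVH cΛ cE₂ cB : ℝ)
  {vh₂S : Fin (d + 1) → Site (d + 1) → Fin (d + 1) → Site (d + 1) → MKer (d + 1) (Fib d)}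
  (mixFF : Fin (d + 1) → Site (d + 1) → Fin (d + 1) → Site (d + 1) → MKer (d + 1) (Fib d)) (j : ℕ) {Cs δs CM δM C₂ δ₂ : ℝ}

/-- NOT IN PRINT; OUR BOOKKEEPING.  **ROW W3-F2a AT MEMBER `j`, POINTWISE TRANSVERSAL FORM, GIVEN THE FOUR CHANNEL BOND SUMS.**  For the
LITERAL source of leaf-04's `T2RecursionAffine.unitS₂_T2Of_succ_affine` —
`b_j κ u κ′ u′ = (cE₂·Lc^{2(d+1)}) • mmRead Lc (K3OfK K♮_j Lc S♮_j M♮_j (W2SymOfK K♮_j Lc S♮_j M♮_j 0 M₂♮_j) κ u κ′ u′) + cB • mfNeg (vh₂S κ u κ′ u′)`,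
`K♮_j = unitK (sfStep Lc j) (smStep d Lc j) (KInvStep Lc j)`, `S♮_j = unitS … (Spure … j)`, `M♮_j = unitM … (M1 … j)`, `M₂♮_j = unitM₂ … (M2Of mixFF j)` —
with an off-diagonal-valued border (`hBff`, as in that theorem) and level-`j` shape data for `S♮_j` (`LocStencil`), `M♮_j` (`VertexFamily`),
`M₂♮_j` (`LocStencilFM`, jointly block covariant): at every first bond `(κ, u)`, `Σ'_{u′} Σ'_x Σ'_z b_j κ u κ′ u′ x z (inl α) (inl β) = 0`
PROVIDED the four (S3c)-channel ff double-leg bond sums of §6 vanish at these data (leaf-06-g9's announced «W3-S3C*» PART 6).  The border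
contributes nothing (`StepJetData.mfNeg_inl_inl` + `hBff`); the value part is §6. -/
theorem inner_bracket_eq_zero
    (hBff : ∀ κ u κ' u' x z (α β : Fin (d + 1)), vh₂S κ u κ' u' x z (Sum.inl α) (Sum.inl β) = 0)
    (hS : LocStencil (unitS (sfStep Lc j) (smStep d Lc j) (Spure d Lc cE cVH cΛ j)) Cs δs) (hδs : 0 < δs)
    (hM : VertexFamily (unitM (sfStep Lc j) (smStep d Lc j) (M1 d Lc cΛ j)) Lc CM δM) (hδM : 0 < δM)
    (hM₂ : LocStencilFM Lc (unitM₂ (sfStep Lc j) (smStep d Lc j) (M2Of d Lc mixFF j)) C₂ δ₂) (hδ₂ : 0 < δ₂)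
    (hM₂t : ∀ (κ : Fin (d + 1)) (u : Site (d + 1)) (ρ : Fin (d + 1)) (w t : Site (d + 1)),
      unitM₂ (sfStep Lc j) (smStep d Lc j) (M2Of d Lc mixFF j) κ (u + (Lc : ℤ) • t) ρ (w + t)
        = shiftK (-((Lc : ℤ) • t)) (unitM₂ (sfStep Lc j) (smStep d Lc j) (M2Of d Lc mixFF j) κ u ρ w))
    (κ : Fin (d + 1)) (u : Site (d + 1)) (κ' α β : Fin (d + 1))
    (hE₁ : HasSum (fun u' : Site (d + 1) => ∑' yw : Site (d + 1) × Site (d + 1),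
      comp (comp (dM (unitK (sfStep Lc j) (smStep d Lc j) (KInvStep (d := d) Lc j)) Lc
          (unitS (sfStep Lc j) (smStep d Lc j) (Spure d Lc cE cVH cΛ j)) (unitM (sfStep Lc j) (smStep d Lc j) (M1 d Lc cΛ j)) κ u)
        (unitK (sfStep Lc j) (smStep d Lc j) (KInvStep (d := d) Lc j)))
        (dM (unitK (sfStep Lc j) (smStep d Lc j) (KInvStep (d := d) Lc j)) Lc
          (unitS (sfStep Lc j) (smStep d Lc j) (Spure d Lc cE cVH cΛ j)) (unitM (sfStep Lc j) (smStep d Lc j) (M1 d Lc cΛ j)) κ' u')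
        yw.1 yw.2 (Sum.inl α) (Sum.inl β)) 0)
    (hE₂ : HasSum (fun u' : Site (d + 1) => ∑' yw : Site (d + 1) × Site (d + 1),
      comp (comp (dM (unitK (sfStep Lc j) (smStep d Lc j) (KInvStep (d := d) Lc j)) Lc
          (unitS (sfStep Lc j) (smStep d Lc j) (Spure d Lc cE cVH cΛ j)) (unitM (sfStep Lc j) (smStep d Lc j) (M1 d Lc cΛ j)) κ' u')
        (unitK (sfStep Lc j) (smStep d Lc j) (KInvStep (d := d) Lc j)))
        (dM (unitK (sfStep Lc j) (smStep d Lc j) (KInvStep (d := d) Lc j)) Lc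
          (unitS (sfStep Lc j) (smStep d Lc j) (Spure d Lc cE cVH cΛ j)) (unitM (sfStep Lc j) (smStep d Lc j) (M1 d Lc cΛ j)) κ u)
        yw.1 yw.2 (Sum.inl α) (Sum.inl β)) 0)
    (hR₁ : HasSum (fun u' : Site (d + 1) => ∑' yw : Site (d + 1) × Site (d + 1),
      dM (K2OfK (unitK (sfStep Lc j) (smStep d Lc j) (KInvStep (d := d) Lc j)) Lc
          (unitS (sfStep Lc j) (smStep d Lc j) (Spure d Lc cE cVH cΛ j)) (unitM (sfStep Lc j) (smStep d Lc j) (M1 d Lc cΛ j)) κ' u') Lc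
        (unitS (sfStep Lc j) (smStep d Lc j) (Spure d Lc cE cVH cΛ j)) (unitM (sfStep Lc j) (smStep d Lc j) (M1 d Lc cΛ j)) κ u
        yw.1 yw.2 (Sum.inl α) (Sum.inl β)) 0)
    (hR₂ : HasSum (fun u' : Site (d + 1) => ∑' yw : Site (d + 1) × Site (d + 1),
      dM (K2OfK (unitK (sfStep Lc j) (smStep d Lc j) (KInvStep (d := d) Lc j)) Lc
          (unitS (sfStep Lc j) (smStep d Lc j) (Spure d Lc cE cVH cΛ j)) (unitM (sfStep Lc j) (smStep d Lc j) (M1 d Lc cΛ j)) κ u) Lc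
        (unitS (sfStep Lc j) (smStep d Lc j) (Spure d Lc cE cVH cΛ j)) (unitM (sfStep Lc j) (smStep d Lc j) (M1 d Lc cΛ j)) κ' u'
        yw.1 yw.2 (Sum.inl α) (Sum.inl β)) 0) :
    (∑' u', ∑' x, ∑' z,
      (((cE₂ * (Lc : ℝ) ^ (2 * (d + 1))) •
          mmRead Lc (K3OfK (unitK (sfStep Lc j) (smStep d Lc j) (KInvStep (d := d) Lc j)) Lc
            (unitS (sfStep Lc j) (smStep d Lc j) (Spure d Lc cE cVH cΛ j)) (unitM (sfStep Lc j) (smStep d Lc j) (M1 d Lc cΛ j))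
            (W2SymOfK (unitK (sfStep Lc j) (smStep d Lc j) (KInvStep (d := d) Lc j)) Lc
              (unitS (sfStep Lc j) (smStep d Lc j) (Spure d Lc cE cVH cΛ j)) (unitM (sfStep Lc j) (smStep d Lc j) (M1 d Lc cΛ j)) 0
              (unitM₂ (sfStep Lc j) (smStep d Lc j) (M2Of d Lc mixFF j))) κ u κ' u')
        + cB • mfNeg (vh₂S κ u κ' u')) x z (Sum.inl α) (Sum.inl β))) = 0 := by
  have h0 : ∀ u' x z, (((cE₂ * (Lc : ℝ) ^ (2 * (d + 1))) •
          mmRead Lc (K3OfK (unitK (sfStep Lc j) (smStep d Lc j) (KInvStep (d := d) Lc j)) Lc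
            (unitS (sfStep Lc j) (smStep d Lc j) (Spure d Lc cE cVH cΛ j)) (unitM (sfStep Lc j) (smStep d Lc j) (M1 d Lc cΛ j))
            (W2SymOfK (unitK (sfStep Lc j) (smStep d Lc j) (KInvStep (d := d) Lc j)) Lc
              (unitS (sfStep Lc j) (smStep d Lc j) (Spure d Lc cE cVH cΛ j)) (unitM (sfStep Lc j) (smStep d Lc j) (M1 d Lc cΛ j)) 0
              (unitM₂ (sfStep Lc j) (smStep d Lc j) (M2Of d Lc mixFF j))) κ u κ' u')
        + cB • mfNeg (vh₂S κ u κ' u')) x z (Sum.inl α) (Sum.inl β))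
      = (cE₂ * (Lc : ℝ) ^ (2 * (d + 1))) *
          mmRead Lc (K3OfK (unitK (sfStep Lc j) (smStep d Lc j) (KInvStep (d := d) Lc j)) Lc
            (unitS (sfStep Lc j) (smStep d Lc j) (Spure d Lc cE cVH cΛ j)) (unitM (sfStep Lc j) (smStep d Lc j) (M1 d Lc cΛ j))
            (W2SymOfK (unitK (sfStep Lc j) (smStep d Lc j) (KInvStep (d := d) Lc j)) Lc
              (unitS (sfStep Lc j) (smStep d Lc j) (Spure d Lc cE cVH cΛ j)) (unitM (sfStep Lc j) (smStep d Lc j) (M1 d Lc cΛ j)) 0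
              (unitM₂ (sfStep Lc j) (smStep d Lc j) (M2Of d Lc mixFF j))) κ u κ' u') x z (Sum.inl α) (Sum.inl β) := by
    intro u' x z
    simp only [Pi.add_apply, Pi.smul_apply, smul_eq_mul, mfNeg_inl_inl, hBff, mul_zero, add_zero]
  simp_rw [h0, tsum_mul_left]
  rw [inner_value_unitKStep_eq_zero (sfStep Lc j) (smStep d Lc j) j hS hδs hM hδM hM₂ hδ₂ hM₂t κ u κ' α β hE₁ hE₂ hR₁ hR₂, mul_zero]

/-- NOT IN PRINT; OUR BOOKKEEPING.  **ROW W3-F2a AT MEMBER `j`, CELL FORM** (leaf-02's `BiStencilZeroMode.zmode`, any period `P`; R14-6's ff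
slots): under the hypotheses of `inner_bracket_eq_zero` holding at EVERY first bond `u` of direction `κ`,
`zmode P (b_j) κ κ′ (inl α) (inl β) = 0` (leaf-16's `zmode_eq_zero_of_inner_eq_zero` — no covariance needed in this direction). -/
theorem zmode_bracket_eq_zero (P : ℕ)
    (hBff : ∀ κ u κ' u' x z (α β : Fin (d + 1)), vh₂S κ u κ' u' x z (Sum.inl α) (Sum.inl β) = 0)
    (hS : LocStencil (unitS (sfStep Lc j) (smStep d Lc j) (Spure d Lc cE cVH cΛ j)) Cs δs) (hδs : 0 < δs)
    (hM : VertexFamily (unitM (sfStep Lc j) (smStep d Lc j) (M1 d Lc cΛ j)) Lc CM δM) (hδM : 0 < δM)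
    (hM₂ : LocStencilFM Lc (unitM₂ (sfStep Lc j) (smStep d Lc j) (M2Of d Lc mixFF j)) C₂ δ₂) (hδ₂ : 0 < δ₂)
    (hM₂t : ∀ (κ : Fin (d + 1)) (u : Site (d + 1)) (ρ : Fin (d + 1)) (w t : Site (d + 1)),
      unitM₂ (sfStep Lc j) (smStep d Lc j) (M2Of d Lc mixFF j) κ (u + (Lc : ℤ) • t) ρ (w + t)
        = shiftK (-((Lc : ℤ) • t)) (unitM₂ (sfStep Lc j) (smStep d Lc j) (M2Of d Lc mixFF j) κ u ρ w))
    (κ κ' α β : Fin (d + 1))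
    (hE₁ : ∀ u : Site (d + 1), HasSum (fun u' : Site (d + 1) => ∑' yw : Site (d + 1) × Site (d + 1),
      comp (comp (dM (unitK (sfStep Lc j) (smStep d Lc j) (KInvStep (d := d) Lc j)) Lc
          (unitS (sfStep Lc j) (smStep d Lc j) (Spure d Lc cE cVH cΛ j)) (unitM (sfStep Lc j) (smStep d Lc j) (M1 d Lc cΛ j)) κ u)
        (unitK (sfStep Lc j) (smStep d Lc j) (KInvStep (d := d) Lc j)))
        (dM (unitK (sfStep Lc j) (smStep d Lc j) (KInvStep (d := d) Lc j)) Lc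
          (unitS (sfStep Lc j) (smStep d Lc j) (Spure d Lc cE cVH cΛ j)) (unitM (sfStep Lc j) (smStep d Lc j) (M1 d Lc cΛ j)) κ' u')
        yw.1 yw.2 (Sum.inl α) (Sum.inl β)) 0)
    (hE₂ : ∀ u : Site (d + 1), HasSum (fun u' : Site (d + 1) => ∑' yw : Site (d + 1) × Site (d + 1),
      comp (comp (dM (unitK (sfStep Lc j) (smStep d Lc j) (KInvStep (d := d) Lc j)) Lc
          (unitS (sfStep Lc j) (smStep d Lc j) (Spure d Lc cE cVH cΛ j)) (unitM (sfStep Lc j) (smStep d Lc j) (M1 d Lc cΛ j)) κ' u')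
        (unitK (sfStep Lc j) (smStep d Lc j) (KInvStep (d := d) Lc j)))
        (dM (unitK (sfStep Lc j) (smStep d Lc j) (KInvStep (d := d) Lc j)) Lc
          (unitS (sfStep Lc j) (smStep d Lc j) (Spure d Lc cE cVH cΛ j)) (unitM (sfStep Lc j) (smStep d Lc j) (M1 d Lc cΛ j)) κ u)
        yw.1 yw.2 (Sum.inl α) (Sum.inl β)) 0)
    (hR₁ : ∀ u : Site (d + 1), HasSum (fun u' : Site (d + 1) => ∑' yw : Site (d + 1) × Site (d + 1),
      dM (K2OfK (unitK (sfStep Lc j) (smStep d Lc j) (KInvStep (d := d) Lc j)) Lc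
          (unitS (sfStep Lc j) (smStep d Lc j) (Spure d Lc cE cVH cΛ j)) (unitM (sfStep Lc j) (smStep d Lc j) (M1 d Lc cΛ j)) κ' u') Lc
        (unitS (sfStep Lc j) (smStep d Lc j) (Spure d Lc cE cVH cΛ j)) (unitM (sfStep Lc j) (smStep d Lc j) (M1 d Lc cΛ j)) κ u
        yw.1 yw.2 (Sum.inl α) (Sum.inl β)) 0)
    (hR₂ : ∀ u : Site (d + 1), HasSum (fun u' : Site (d + 1) => ∑' yw : Site (d + 1) × Site (d + 1),
      dM (K2OfK (unitK (sfStep Lc j) (smStep d Lc j) (KInvStep (d := d) Lc j)) Lc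
          (unitS (sfStep Lc j) (smStep d Lc j) (Spure d Lc cE cVH cΛ j)) (unitM (sfStep Lc j) (smStep d Lc j) (M1 d Lc cΛ j)) κ u) Lc
        (unitS (sfStep Lc j) (smStep d Lc j) (Spure d Lc cE cVH cΛ j)) (unitM (sfStep Lc j) (smStep d Lc j) (M1 d Lc cΛ j)) κ' u'
        yw.1 yw.2 (Sum.inl α) (Sum.inl β)) 0) :
    zmode P (fun κ u κ' u' =>
      ((cE₂ * (Lc : ℝ) ^ (2 * (d + 1))) •
          mmRead Lc (K3OfK (unitK (sfStep Lc j) (smStep d Lc j) (KInvStep (d := d) Lc j)) Lc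
            (unitS (sfStep Lc j) (smStep d Lc j) (Spure d Lc cE cVH cΛ j)) (unitM (sfStep Lc j) (smStep d Lc j) (M1 d Lc cΛ j))
            (W2SymOfK (unitK (sfStep Lc j) (smStep d Lc j) (KInvStep (d := d) Lc j)) Lc
              (unitS (sfStep Lc j) (smStep d Lc j) (Spure d Lc cE cVH cΛ j)) (unitM (sfStep Lc j) (smStep d Lc j) (M1 d Lc cΛ j)) 0
              (unitM₂ (sfStep Lc j) (smStep d Lc j) (M2Of d Lc mixFF j))) κ u κ' u')
        + cB • mfNeg (vh₂S κ u κ' u'))) κ κ' (Sum.inl α) (Sum.inl β) = 0 :=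
  zmode_eq_zero_of_inner_eq_zero P fun u =>
    inner_bracket_eq_zero cE cVH cΛ cE₂ cB mixFF j hBff hS hδs hM hδM hM₂ hδ₂ hM₂t κ u κ' α β (hE₁ u) (hE₂ u) (hR₁ u) (hR₂ u)

end Literal

end Summit.QuantumFields.BalabanUV.Beta.GAN24.WSlotSourceZeroModeStep

end
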